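import Mathlib
import Literature.NumberTheory.LFunctions.Zhang2022.Section13ZeroSumQuadratic
import Literature.NumberTheory.LFunctions.Zhang2022.Section13ConjugateAFE
import Literature.NumberTheory.LFunctions.Zhang2022.Section6LFunctionStripGrowth
import Literature.NumberTheory.LFunctions.Zhang2022.SkeletonWindowPowers
import HarnessLib

/-!
# Zhang (2022) §13 (13.11): the quadratic zero-sum of the `L`-factor alone —
# `Σ_{ψ∈Ψ₁}Σ_{ρ∈𝔷(ψ)} |L(ρ+β₁,ψ)/L′(ρ,ψ)|·|L(ρ+β,ψ)|²·ω(ρ) ≪ 𝔓𝓛^{kL+9}` (item Z-L)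

Topic `Literature/NumberTheory/LFunctions/Zhang2022` (Landau–Siegel audit tree; verdict-neutral).
Y. Zhang, *Discrete mean estimates and the Landau–Siegel zero*, arXiv:2211.02515v1 (2022)
[Zhang2022LandauSiegel], §13 p. 75 (tex L3806–L3817: "Combining (2.34), Cauchy's inequality,
Proposition 7.1, Lemma 5.9, 6.1 and 3.3, we can verify that `𝓔 = o(𝔓)`" — not carried out in print,
GAP row G-L3t6-3) — an unrefereed manuscript under adjudication; nothing here asserts or denies its
Theorems 1–2 and nothing here is about Landau–Siegel zeros. ZHANG-L discharge lane, WP14, helper under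
the leaf `h1311` `Skeleton.Eq1311Rel c′ c137` (leaf owner zl-w14-p5; item Z-L of the owner's table
2026-08-27T00:42Z, ruling W14-R2/R2a: the zero-side layer for the `L`-factor ALONE, 𝔓-currency).

In the owner's Cauchy–Schwarz frame every `L`-carrying term of `𝓔` (S2, S3: `‖L(ρ+β₂,ψ)‖·…`) is
split as (the `L`-factor alone) × (a short Dirichlet-polynomial factor), so the zero side needs
`Q_L(β) = Σ_{ψ∈Ψ₁}Σ_ρ |L(ρ+β₁,ψ)/L′(ρ,ψ)|·|L(ρ+β,ψ)|²·|ω(ρ)|` for purely imaginary `β` (`β = β_j`).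
This THEOREM-ONLY file proves, for `c′ ≥ 0` with `Skeleton.Prop22 c′`,

* `zeroSum_L_sq_le_of_prop22` — given the single-factor mean value **I3-L** on the two lines
  `σ = ½ ± α` as a hypothesis in the shape of record (typer scratch v5 `meanSq_L_le`, owner zl-w14-p7:
  `Σ_{ψ∈T}|L(w,ψ)|² ≤ C·𝔓·𝓛^{kL}` for `|Re w − ½| ≤ α`, `|Im w − 2πt₀| < 𝓛₁ + 2`, under (A)), for all
  large `D` under (A), every `β` with `Re β = 0`, `‖β‖ ≤ 1`: `Q_L(β) ≤ C'·𝔓·𝓛^{kL+9}`.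

Route (kernel-checked, the `L`-twin of zl-w14-p6's `zeroSum_dirPoly_sq_le_of_prop22`): per `ψ`, the
generic zero-sum bound `zeroSum_weight_le_of_prop22` (`Section13ZeroSumBound` = the (2.34)/residue
conversion + Lemma 5.9 on `𝒥(±α)`) with the holomorphic co-factor `H(s) = L(s+β,ψ)·L(1−s−β,ψ̄)`, which
at a critical zero `ρ` (`Re ρ = ½`, Proposition 2.2 (i)) equals `|L(ρ+β,ψ)|²` (`LFunction_inv_conj`)
while `ω(ρ) > 0`; on the lines `|H(s)| ≤ ½(|L(s+β,ψ)|² + |L(1−s̄+β,ψ)|²)` and `1 − s̄` lies on the other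
line, so I3-L applies at both points; (7.4) `∫_{𝒥(±α)}|ω| ≤ 2πe^{1/4}`; the remainder
`K·H_max·e^{−𝓛¹⁰/8}` per `ψ` with `H_max = (4(2P)³ζ(5/4)(2πt₀+𝓛₁+4)³)²` from the strip growth of `L`
(`StripGrowth.norm_LFunction_le_of_abs_re_le`, §6) is absorbed (`P⁶t₀⁶e^{−𝓛¹⁰/8} ≤ 1` once `𝓛 ≥ 56`),
`#Ψ₁ ≤ 𝔓`. No definition, no new claim; the S1-type two-factor `L(ρ+β₂)L(ρ+β₃)` zero-sum (P²-currency)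
is NOT here.

## References

* Y. Zhang, arXiv:2211.02515v1 (2022), §13 p. 75, tex L3806–L3817; §6 Lemma 6.1 and p. 30 (strip
  growth); §7 (7.4); §2 (2.34). [cite: Zhang2022LandauSiegel, §13 (13.11) p.75]
-/

noncomputable section

open Complex Real Set Filter Topology MeasureTheory intervalIntegral ComplexConjugate

namespace Literature.NumberTheory.LFunctions.Zhang2022.Typed.Section13

open Skeleton GammaFactor Section8aStatements

/-! ## The co-factor `H(s) = L(s+β,ψ)·L(1−s−β,ψ̄)` -/

/-- At a point of the critical line, `L(ρ+β,ψ)·L(1−ρ−β,ψ̄) = |L(ρ+β,ψ)|²` for purely imaginary `β`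
(`1 − ρ − β = conj(ρ + β)`, `L(w̄,ψ̄) = conj L(w,ψ)`). [cite: Zhang2022LandauSiegel, §13 p.75 (last display)] -/
theorem LFunction_mul_refl_of_re_half {D : ℕ} (x : Chr D) {β ρ : ℂ} (hβ : β.re = 0)
    (hρ : ρ.re = 1 / 2) :
    x.ψ.LFunction (ρ + β) * x.ψ⁻¹.LFunction (1 - ρ - β) =
      ((‖x.ψ.LFunction (ρ + β)‖ ^ 2 : ℝ) : ℂ) := by
  have h1 : (1 : ℂ) - ρ - β = conj (ρ + β) := by
    apply Complex.ext
    · simp [hρ, hβ]; norm_num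
    · simp; ring
  rw [h1, LFunction_inv_conj, Complex.conj_conj, Complex.mul_conj, Complex.normSq_eq_norm_sq]

/-- `|L(1−s−β,ψ̄)| = |L(1−s̄+β,ψ)|` for purely imaginary `β`. [cite: Zhang2022LandauSiegel, §13 p.75] -/
theorem norm_LFunction_inv_refl {D : ℕ} (x : Chr D) {β : ℂ} (hβ : β.re = 0) (s : ℂ) :
    ‖x.ψ⁻¹.LFunction (1 - s - β)‖ = ‖x.ψ.LFunction (1 - conj s + β)‖ := by
  rw [LFunction_inv_conj, Complex.norm_conj]
  have hb : conj β = -β := by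
    apply Complex.ext
    · simp [hβ]
    · simp
  congr 2
  rw [map_sub, map_sub, map_one, hb]
  ring

/-! ## Sizes -/

/-- For `𝓛 ≥ 56`: `α ≤ ¼`, `𝓛₁ + 154 ≤ 2πt₀`, `𝓛₁ + 4 ≤ t₀`, and the remainder absorption
`(2P)⁶·(8t₀)⁶·e^{−𝓛¹⁰/8} ≤ 1`. [cite: Zhang2022LandauSiegel, §2 (2.6), (2.8), (2.10)] -/
private theorem sizes {D : ℕ} (h56 : 56 ≤ ell D) :
    alpha D ≤ 1 / 4 ∧ ell1 D + 154 ≤ 2 * π * t0 D ∧ ell1 D + 4 ≤ t0 D ∧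
      (2 * bigP D) ^ 6 * (8 * t0 D) ^ 6 * Real.exp (-(ell D ^ 10 / 8)) ≤ 1 := by
  have hL1 : 1 ≤ ell D := by linarith
  have hL0 : 0 < ell D := by linarith
  have hlogP : Real.log (bigP D) = ell D ^ 9 := by rw [bigP, Real.log_exp]
  -- α ≤ 1/4
  have hα : alpha D ≤ 1 / 4 := by
    rw [alpha, hlogP, div_le_iff₀ (pow_pos hL0 9)]
    have h512 : (512 : ℝ) ≤ ell D ^ 9 := by
      calc (512 : ℝ) = 2 ^ 9 := by norm_num
        _ ≤ ell D ^ 9 := pow_le_pow_left₀ (by norm_num) (by linarith) 9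
    nlinarith [Real.pi_lt_four]
  -- ℓ₁ + 154 ≤ t₀ ≤ 2π t₀
  have ht0 : ell1 D + 154 ≤ t0 D := by
    rw [ell1, t0]
    have h405 : (154 : ℝ) ≤ ell D ^ 405 := by
      calc (154 : ℝ) ≤ 56 ^ 2 := by norm_num
        _ ≤ ell D ^ 2 := pow_le_pow_left₀ (by norm_num) h56 2
        _ ≤ ell D ^ 405 := pow_le_pow_right₀ hL1 (by norm_num)
    have h114 : (2 : ℝ) ≤ ell D ^ 114 := by
      calc (2 : ℝ) ≤ 56 := by norm_num
        _ ≤ ell D := h56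
        _ ≤ ell D ^ 114 := le_self_pow₀ hL1 (by norm_num)
    have : ell D ^ 519 = ell D ^ 405 * ell D ^ 114 := by ring
    nlinarith [pow_nonneg hL0.le 405]
  have ht0' : ell1 D + 4 ≤ t0 D := by linarith
  have ht00 : 0 ≤ t0 D := by rw [t0]; exact pow_nonneg hL0.le _
  have h2π : ell1 D + 154 ≤ 2 * π * t0 D := by nlinarith [Real.pi_gt_three]
  refine ⟨hα, h2π, ht0', ?_⟩
  -- the absorption
  have hP : (2 * bigP D) ^ 6 ≤ Real.exp (6 + 6 * ell D ^ 9) := by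
    have h2 : (2 : ℝ) ≤ Real.exp 1 := by linarith [Real.add_one_le_exp (1 : ℝ)]
    calc (2 * bigP D) ^ 6 ≤ (Real.exp 1 * Real.exp (ell D ^ 9)) ^ 6 := by
          rw [bigP]; gcongr
      _ = Real.exp (6 + 6 * ell D ^ 9) := by
          rw [← Real.exp_add, ← Real.exp_nat_mul]; ring_nf
  have ht : (8 * t0 D) ^ 6 ≤ Real.exp (18 + 3114 * ell D) := by
    have h8 : (8 : ℝ) ≤ Real.exp 3 := by
      have := Real.add_one_le_exp (1 : ℝ)
      have h3 : Real.exp 3 = Real.exp 1 * Real.exp 1 * Real.exp 1 := by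
        rw [← Real.exp_add, ← Real.exp_add]; norm_num
      rw [h3]; nlinarith [Real.exp_pos (1 : ℝ)]
    have hℓ : ell D ≤ Real.exp (ell D) := by linarith [Real.add_one_le_exp (ell D)]
    calc (8 * t0 D) ^ 6 = 8 ^ 6 * (ell D ^ 519) ^ 6 := by rw [t0]; ring
      _ ≤ (Real.exp 3) ^ 6 * (Real.exp (ell D) ^ 519) ^ 6 := by
          gcongr
      _ = Real.exp (18 + 3114 * ell D) := by
          rw [← Real.exp_nat_mul, ← Real.exp_nat_mul, ← Real.exp_nat_mul, ← Real.exp_add]; ring_nf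
  have hkey : 6 + 6 * ell D ^ 9 + (18 + 3114 * ell D) ≤ ell D ^ 10 / 8 := by
    have h8 : (3138 : ℝ) ≤ ell D ^ 8 := by
      calc (3138 : ℝ) ≤ 56 ^ 3 := by norm_num
        _ ≤ ell D ^ 3 := pow_le_pow_left₀ (by norm_num) h56 3
        _ ≤ ell D ^ 8 := pow_le_pow_right₀ hL1 (by norm_num)
    have h9 : ell D ^ 9 = ell D ^ 8 * ell D := by ring
    have h10 : ell D ^ 10 = ell D ^ 9 * ell D := by ring
    nlinarith [pow_nonneg hL0.le 8, pow_nonneg hL0.le 9]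
  calc (2 * bigP D) ^ 6 * (8 * t0 D) ^ 6 * Real.exp (-(ell D ^ 10 / 8))
      ≤ Real.exp (6 + 6 * ell D ^ 9) * Real.exp (18 + 3114 * ell D) * Real.exp (-(ell D ^ 10 / 8)) := by
        gcongr
    _ = Real.exp (6 + 6 * ell D ^ 9 + (18 + 3114 * ell D) - ell D ^ 10 / 8) := by
        rw [← Real.exp_add, ← Real.exp_add]; ring_nf
    _ ≤ Real.exp 0 := Real.exp_le_exp.mpr (by linarith)
    _ = 1 := Real.exp_zero

/-! ## The zero-sum of the `L`-factor alone -/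

set_option maxHeartbeats 800000 in
/-- **Z-L: the quadratic zero-sum of `L(ρ+β,ψ)` alone, from Proposition 2.2 and the single-factor mean
value I3-L** (§13 p.75 "(2.34), Cauchy's inequality, …, Lemma 5.9, 6.1 and 3.3"): for `c′ ≥ 0` with
`Skeleton.Prop22 c′`, and GIVEN the mean value `Σ_{ψ∈T}|L(w,ψ)|² ≤ C·𝔓·𝓛^{kL}` on
`|Re w − ½| ≤ α`, `|Im w − 2πt₀| < 𝓛₁ + 2` under (A) (item I3-L, the shape of record `meanSq_L_le`),
there is `C'` with, for all large `D`, every real primitive `χ` with (A), every `β` with `Re β = 0`,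
`‖β‖ ≤ 1`:
`Σ_{ψ∈Ψ₁}Σ_{ρ∈𝔷(ψ)} |L(ρ+β₁,ψ)/L′(ρ,ψ)|·|L(ρ+β,ψ)|²·|ω(ρ)| ≤ C'·𝔓·𝓛^{kL+9}`.
[cite: Zhang2022LandauSiegel, §13 (13.11) p.75, tex L3806–L3817] -/
theorem zeroSum_L_sq_le_of_prop22 (kL : ℕ)
    (hmsL : ∃ C : ℝ, ForAllLarge fun D _ χ => AssumptionA D χ →
      ∀ (T : Finset (Chr D)) (w : ℂ), |w.re - 1 / 2| ≤ alpha D →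
        |w.im - 2 * π * t0 D| < ell1 D + 2 →
          ∑ x ∈ T, ‖x.ψ.LFunction w‖ ^ 2 ≤ C * frakP D * ell D ^ kL)
    {c' : ℝ} (hc' : 0 ≤ c') (h22 : Prop22 c') :
    ∃ C : ℝ, ForAllLarge fun D _ χ => AssumptionA D χ → ∀ β : ℂ, β.re = 0 → ‖β‖ ≤ 1 →
      (∑ x ∈ finsetOf (PsiOne χ), ∑ ρ ∈ finsetOf (zeroSet D x),
          ‖x.ψ.LFunction (ρ + beta1 c' D) / deriv x.ψ.LFunction ρ‖ *
            ‖x.ψ.LFunction (ρ + β)‖ ^ 2 * ‖omegaW D ρ‖) ≤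
        C * frakP D * ell D ^ (kL + 9) := by
  obtain ⟨K, hK0, C₇, hC₇, D₁, hW⟩ := zeroSum_weight_le_of_prop22 hc' h22
  obtain ⟨D₂, h22i⟩ := h22.1
  obtain ⟨CL, D₃, hL⟩ := hmsL
  obtain ⟨D₄, hD₄⟩ := exists_nat_forall_le_ell 56
  set Z : ℝ := ∑' n : ℕ, ((n + 1 : ℕ) : ℝ) ^ (-(5 / 4 : ℝ)) with hZ
  have hZ0 : 0 ≤ Z := tsum_nonneg fun n => Real.rpow_nonneg (Nat.cast_nonneg _) _
  set CL' : ℝ := max CL 0 with hCL'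
  have hCL'0 : 0 ≤ CL' := le_max_right _ _
  refine ⟨2 * (C₇ * (2 * π * Real.exp (1 / 4))) * CL' + K * (16 * Z ^ 2),
    max (max D₁ D₂) (max D₃ D₄), fun D _ χ hD hq hp hA β hβre hβ1 => ?_⟩
  have hD₁ : D₁ ≤ D := (le_max_left _ _).trans ((le_max_left _ _).trans hD)
  have hD₂ : D₂ ≤ D := (le_max_right _ _).trans ((le_max_left _ _).trans hD)
  have hD₃ : D₃ ≤ D := (le_max_left _ _).trans ((le_max_right _ _).trans hD)
  have h56 : 56 ≤ ell D := hD₄ D ((le_max_right _ _).trans ((le_max_right _ _).trans hD))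
  obtain ⟨hα4, h2πt, hℓ1t0, habs⟩ := sizes h56
  have hℓ3 : 3 ≤ ell D := by linarith
  have hD3 : 3 ≤ D := by
    by_contra h
    have hD2 : (D : ℝ) ≤ 2 := by exact_mod_cast (by omega : D ≤ 2)
    have : ell D ≤ Real.log 2 := by
      rcases Nat.eq_zero_or_pos D with h0 | hpos
      · rw [ell, h0]; simp; exact Real.log_nonneg (by norm_num)
      · exact Real.log_le_log (by exact_mod_cast hpos) hD2
    linarith [Real.log_two_lt_d9]
  have hℓ1 : 1 < ell D := one_lt_ell hD3
  have hℓpos : 0 < ell D := by linarith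
  have hlogP : Real.log (bigP D) = ell D ^ 9 := by rw [bigP, Real.log_exp]
  have hα : 0 < alpha D := by
    rw [alpha, hlogP]; exact div_pos Real.pi_pos (pow_pos hℓpos 9)
  have hℓ1pos : 0 < ell1 D := by rw [ell1]; exact pow_pos hℓpos _
  have hℓ2pos : 0 < ell2 D := by rw [ell2]; exact pow_pos hℓpos _
  have hℓt : ell1 D < 2 * π * t0 D := by linarith
  have hαℓ2 : |alpha D| ≤ ell2 D := by
    rw [abs_of_pos hα, ell2]
    have : (1 : ℝ) ≤ ell D ^ 400 := one_le_pow₀ hℓ1.le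
    linarith
  have hαℓ2' : |(-alpha D)| ≤ ell2 D := by rw [abs_neg]; exact hαℓ2
  have hP0 : 0 ≤ frakP D := frakP_nonneg D
  have hbigP0 : 0 ≤ bigP D := (Real.exp_pos _).le
  have ht00 : 0 ≤ t0 D := by rw [t0]; exact pow_nonneg hℓpos.le _
  have hwin0 : 0 ≤ 2 * π * t0 D + ell1 D + 4 := by
    have := mul_nonneg (mul_nonneg zero_le_two Real.pi_pos.le) ht00
    linarith
  have hβim : |β.im| ≤ 1 := (Complex.abs_im_le_norm β).trans hβ1
  -- names
  set T := finsetOf (PsiOne χ) with hT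
  set F : Chr D → ℂ → ℂ := fun x s => x.ψ.LFunction (s + β) with hF
  set H : Chr D → ℂ → ℂ := fun x s => x.ψ.LFunction (s + β) * x.ψ⁻¹.LFunction (1 - s - β) with hH
  obtain ⟨M₁, hM₁⟩ : ∃ M : ℝ, M = 4 * (2 * bigP D) ^ 3 * Z * (2 * π * t0 D + ell1 D + 4) ^ 3 :=
    ⟨_, rfl⟩
  have hM₁0 : 0 ≤ M₁ := by
    rw [hM₁]
    exact mul_nonneg (mul_nonneg (mul_nonneg (by norm_num) (pow_nonneg (by linarith) 3)) hZ0)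
      (pow_nonneg hwin0 3)
  obtain ⟨Hmax, hHmax⟩ : ∃ Hm : ℝ, Hm = M₁ ^ 2 := ⟨_, rfl⟩
  have hHmax0 : 0 ≤ Hmax := by rw [hHmax]; exact sq_nonneg _
  -- the co-factor is holomorphic
  have hHdiff : ∀ x : Chr D, ∀ z : ℂ, 0 < z.im → DifferentiableAt ℂ (H x) z := by
    intro x z _
    have hne : x.ψ ≠ 1 := x.ψ_ne_one
    have hne' : x.ψ⁻¹ ≠ 1 := inv_ne_one.mpr hne
    have h1 : DifferentiableAt ℂ (fun s => x.ψ.LFunction (s + β)) z :=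
      ((DirichletCharacter.differentiable_LFunction hne).comp
        (differentiable_id.add (differentiable_const β))) z
    have h2 : DifferentiableAt ℂ (fun s => x.ψ⁻¹.LFunction (1 - s - β)) z :=
      ((DirichletCharacter.differentiable_LFunction hne').comp
        ((differentiable_const _ |>.sub differentiable_id).sub (differentiable_const β))) z
    exact h1.mul h2
  -- the strip-growth bound for one `L`-value at a point `w` with `Re w ∈ [0,1]`,
  -- `152 ≤ Im w ≤ 2πt₀ + 𝓛₁ + 2`
  have hLpt : ∀ x : Chr D, ∀ w : ℂ, 0 ≤ w.re → w.re ≤ 1 → 152 ≤ w.im →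
      w.im ≤ 2 * π * t0 D + ell1 D + 2 → ‖x.ψ.LFunction w‖ ≤ M₁ := by
    intro x w hw0 hw1 hwlo hwhi
    have hσ : |w.re| ≤ (1 : ℕ) := by
      rw [abs_le]; push_cast; constructor <;> linarith
    have ht : 38 * (((1 : ℕ) : ℝ) + 1) ^ 2 ≤ |w.im| := by
      rw [abs_of_nonneg (by linarith)]; push_cast; linarith
    have h := StripGrowth.norm_LFunction_le_of_abs_re_le x.prim x.p_ne_one (A := 1) le_rfl hσ ht
    rw [show (1 : ℕ) + 2 = 3 from rfl, Nat.cast_one] at h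
    have hp2P : (x.p : ℝ) ≤ 2 * bigP D := le_two_mul_bigP_of_mem_primeWindow hℓ1.le x.mem
    have him : |w.im| + 1 + 1 ≤ 2 * π * t0 D + ell1 D + 4 := by
      rw [abs_of_nonneg (by linarith)]; linarith
    have him0 : 0 ≤ |w.im| + 1 + 1 := by positivity
    have hp0 : 0 ≤ (x.p : ℝ) := Nat.cast_nonneg _
    calc ‖x.ψ.LFunction w‖ ≤ 4 * (x.p : ℝ) ^ 3 * Z * (|w.im| + 1 + 1) ^ 3 := h
      _ ≤ 4 * (2 * bigP D) ^ 3 * Z * (2 * π * t0 D + ell1 D + 4) ^ 3 := by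
          have h1 : (x.p : ℝ) ^ 3 ≤ (2 * bigP D) ^ 3 := pow_le_pow_left₀ hp0 hp2P 3
          have h2 : (|w.im| + 1 + 1) ^ 3 ≤ (2 * π * t0 D + ell1 D + 4) ^ 3 :=
            pow_le_pow_left₀ him0 him 3
          have h3 : 0 ≤ 4 * (2 * bigP D) ^ 3 * Z :=
            mul_nonneg (mul_nonneg (by norm_num) (pow_nonneg (by linarith) 3)) hZ0
          calc 4 * (x.p : ℝ) ^ 3 * Z * (|w.im| + 1 + 1) ^ 3
              ≤ 4 * (2 * bigP D) ^ 3 * Z * (|w.im| + 1 + 1) ^ 3 := by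
                have : 4 * (x.p : ℝ) ^ 3 * Z ≤ 4 * (2 * bigP D) ^ 3 * Z :=
                  mul_le_mul_of_nonneg_right (mul_le_mul_of_nonneg_left h1 (by norm_num)) hZ0
                exact mul_le_mul_of_nonneg_right this (pow_nonneg him0 3)
            _ ≤ 4 * (2 * bigP D) ^ 3 * Z * (2 * π * t0 D + ell1 D + 4) ^ 3 :=
                mul_le_mul_of_nonneg_left h2 h3
      _ = M₁ := hM₁.symm
  -- `|H| ≤ Hmax` on the strip-rectangle
  have hHb : ∀ x : Chr D, ∀ s : ℂ, |s.re - 1 / 2| ≤ alpha D → |s.im - 2 * π * t0 D| ≤ ell1 D + 1 →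
      ‖H x s‖ ≤ Hmax := by
    intro x s hσ hτ
    obtain ⟨h1, h2⟩ := abs_le.mp hσ
    obtain ⟨h3, h4⟩ := abs_le.mp hτ
    have hA : ‖x.ψ.LFunction (s + β)‖ ≤ M₁ := by
      refine hLpt x (s + β) ?_ ?_ ?_ ?_
      · simp [hβre]; linarith
      · simp [hβre]; linarith
      · simp; linarith [abs_le.mp hβim]
      · simp; linarith [abs_le.mp hβim]
    have hB : ‖x.ψ⁻¹.LFunction (1 - s - β)‖ ≤ M₁ := by
      rw [norm_LFunction_inv_refl x hβre s]
      refine hLpt x (1 - conj s + β) ?_ ?_ ?_ ?_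
      · simp [hβre]; linarith
      · simp [hβre]; linarith
      · simp; linarith [abs_le.mp hβim]
      · simp; linarith [abs_le.mp hβim]
    rw [hH]
    show ‖x.ψ.LFunction (s + β) * x.ψ⁻¹.LFunction (1 - s - β)‖ ≤ Hmax
    rw [norm_mul, hHmax, sq]
    exact mul_le_mul hA hB (norm_nonneg _) hM₁0
  -- per character: the real zero-sum is the norm of the complex one, bounded by `hW`
  have hx : ∀ x ∈ T,
      (∑ ρ ∈ finsetOf (zeroSet D x),
          ‖x.ψ.LFunction (ρ + beta1 c' D) / deriv x.ψ.LFunction ρ‖ * ‖F x ρ‖ ^ 2 * ‖omegaW D ρ‖) ≤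
        C₇ * ell D ^ 9 *
            ((∫ v in (-ell1 D)..ell1 D,
                ‖H x ((alpha D : ℂ) + s0 D + v * I)‖ * ‖omegaW D ((alpha D : ℂ) + s0 D + v * I)‖) +
              (∫ v in (-ell1 D)..ell1 D,
                ‖H x (((-alpha D : ℝ) : ℂ) + s0 D + v * I)‖ *
                  ‖omegaW D (((-alpha D : ℝ) : ℂ) + s0 D + v * I)‖)) +
          K * Hmax * Real.exp (-(ell D ^ 10 / 8)) := by
    intro x hxT
    have hxΨ : x ∈ PsiOne χ := mem_of_mem_finsetOf hxT
    have hWx := hW D χ hD₁ hq hp x hxΨ (H x) Hmax hHmax0 (hHdiff x) (hHb x)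
    have hfin : (zeroSet D x).Finite := zerosFinite_holds D x
    have hsum : (∑ ρ ∈ finsetOf (zeroSet D x),
        ((‖x.ψ.LFunction (ρ + beta1 c' D) / deriv x.ψ.LFunction ρ‖ : ℝ) : ℂ) * H x ρ * omegaW D ρ) =
        (((∑ ρ ∈ finsetOf (zeroSet D x),
          ‖x.ψ.LFunction (ρ + beta1 c' D) / deriv x.ψ.LFunction ρ‖ * ‖F x ρ‖ ^ 2 *
            ‖omegaW D ρ‖ : ℝ)) : ℂ) := by
      push_cast
      refine Finset.sum_congr rfl fun ρ hρ => ?_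
      have hρz : ρ ∈ zeroSet D x := (mem_finsetOf hfin).mp hρ
      have hre : ρ.re = 1 / 2 :=
        h22i D χ hD₂ hq hp x hxΨ ρ (mem_prodZeroSetOmega_of_mem_zeroSet χ hρz)
      obtain ⟨hωre, hωim⟩ := omegaW_re_pos hD3 hre
      have hω : omegaW D ρ = ((‖omegaW D ρ‖ : ℝ) : ℂ) := by
        have h1 : omegaW D ρ = (((omegaW D ρ).re : ℝ) : ℂ) :=
          Complex.ext (by simp) (by simp [hωim])
        have h2 : ‖omegaW D ρ‖ = (omegaW D ρ).re := by
          rw [h1, Complex.norm_real, Real.norm_of_nonneg hωre.le]; simp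
        rw [h2]; exact h1
      have hHρ : H x ρ = ((‖F x ρ‖ ^ 2 : ℝ) : ℂ) := by
        rw [hH, hF]
        exact LFunction_mul_refl_of_re_half x hβre hre
      rw [hHρ]
      conv_lhs => rw [hω]
      push_cast
      ring
    have hreal : ‖(∑ ρ ∈ finsetOf (zeroSet D x),
        ((‖x.ψ.LFunction (ρ + beta1 c' D) / deriv x.ψ.LFunction ρ‖ : ℝ) : ℂ) * H x ρ * omegaW D ρ)‖ =
        ∑ ρ ∈ finsetOf (zeroSet D x),
          ‖x.ψ.LFunction (ρ + beta1 c' D) / deriv x.ψ.LFunction ρ‖ * ‖F x ρ‖ ^ 2 * ‖omegaW D ρ‖ := by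
      rw [hsum, Complex.norm_real, Real.norm_of_nonneg]
      exact Finset.sum_nonneg fun ρ _ => by positivity
    rw [← hreal]
    exact hWx
  -- the line integrals, summed over `Ψ₁`: I3-L at the two points and (7.4)
  have hline : ∀ z : ℝ, (z = alpha D ∨ z = -alpha D) →
      (∑ x ∈ T, ∫ v in (-ell1 D)..ell1 D,
          ‖H x ((z : ℂ) + s0 D + v * I)‖ * ‖omegaW D ((z : ℂ) + s0 D + v * I)‖) ≤
        CL' * frakP D * ell D ^ kL * (2 * π * Real.exp (1 / 4)) := by
    intro z hz
    have hzabs : |z| ≤ ell2 D := by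
      rcases hz with h | h
      · rw [h]; exact hαℓ2
      · rw [h]; exact hαℓ2'
    have hzα : |z| = alpha D := by
      rcases hz with h | h
      · rw [h, abs_of_pos hα]
      · rw [h, abs_neg, abs_of_pos hα]
    have hcont : ∀ x : Chr D, ContinuousOn (fun v : ℝ =>
        ‖H x ((z : ℂ) + s0 D + v * I)‖ * ‖omegaW D ((z : ℂ) + s0 D + v * I)‖)
        (Icc (-ell1 D) (ell1 D)) := fun x =>
      continuousOn_normH_mul_normOmega (D := D) (H x) (hHdiff x) z hℓt
    have hint : ∀ x ∈ T, IntervalIntegrable (fun v : ℝ =>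
        ‖H x ((z : ℂ) + s0 D + v * I)‖ * ‖omegaW D ((z : ℂ) + s0 D + v * I)‖) volume
        (-ell1 D) (ell1 D) := fun x _ =>
      ((hcont x).mono (by rw [Set.uIcc_of_le (by linarith)])).intervalIntegrable
    rw [← intervalIntegral.integral_finsetSum hint]
    -- pointwise bound on the line
    have hpt : ∀ v ∈ Icc (-ell1 D) (ell1 D),
        (∑ x ∈ T, ‖H x ((z : ℂ) + s0 D + v * I)‖ * ‖omegaW D ((z : ℂ) + s0 D + v * I)‖) ≤
          CL' * frakP D * ell D ^ kL * ‖omegaW D ((z : ℂ) + s0 D + v * I)‖ := by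
      intro v hv
      obtain ⟨hv1, hv2⟩ := hv
      set s : ℂ := (z : ℂ) + s0 D + v * I with hs
      have hsre : s.re = 1 / 2 + z := by rw [hs]; simp [s0_re]; ring
      have hsim : s.im = 2 * π * t0 D + v := by rw [hs]; simp [s0_im]
      rw [← Finset.sum_mul]
      refine mul_le_mul_of_nonneg_right ?_ (norm_nonneg _)
      -- `Σ_ψ |H| ≤ ½ Σ_ψ (|L(s+β)|² + |L(1 − s̄ + β)|²)`
      have hHle : ∀ x : Chr D, ‖H x s‖ ≤
          (‖x.ψ.LFunction (s + β)‖ ^ 2 + ‖x.ψ.LFunction (1 - conj s + β)‖ ^ 2) / 2 := by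
        intro x
        rw [hH]
        show ‖x.ψ.LFunction (s + β) * x.ψ⁻¹.LFunction (1 - s - β)‖ ≤
          (‖x.ψ.LFunction (s + β)‖ ^ 2 + ‖x.ψ.LFunction (1 - conj s + β)‖ ^ 2) / 2
        rw [norm_mul, norm_LFunction_inv_refl x hβre s]
        nlinarith [two_mul_le_add_sq ‖x.ψ.LFunction (s + β)‖ ‖x.ψ.LFunction (1 - conj s + β)‖,
          norm_nonneg (x.ψ.LFunction (s + β)), norm_nonneg (x.ψ.LFunction (1 - conj s + β))]
      -- the two points are on the lines `σ = ½ ± α` within the height window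
      have hw1re : |(s + β).re - 1 / 2| ≤ alpha D := by
        simp only [Complex.add_re, hβre, hsre, add_zero]
        rw [show 1 / 2 + z - 1 / 2 = z by ring, hzα]
      have hw1im : |(s + β).im - 2 * π * t0 D| < ell1 D + 2 := by
        simp only [Complex.add_im, hsim]
        rw [show 2 * π * t0 D + v + β.im - 2 * π * t0 D = v + β.im by ring]
        have := abs_add_le v β.im
        have hvabs : |v| ≤ ell1 D := abs_le.mpr ⟨hv1, hv2⟩
        linarith
      have hw2re : |(1 - conj s + β).re - 1 / 2| ≤ alpha D := by
        simp only [Complex.add_re, Complex.sub_re, Complex.one_re, Complex.conj_re, hβre, hsre,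
          add_zero]
        rw [show 1 - (1 / 2 + z) - 1 / 2 = -z by ring, abs_neg, hzα]
      have hw2im : |(1 - conj s + β).im - 2 * π * t0 D| < ell1 D + 2 := by
        simp only [Complex.add_im, Complex.sub_im, Complex.one_im, Complex.conj_im, hsim]
        rw [show 0 - -(2 * π * t0 D + v) + β.im - 2 * π * t0 D = v + β.im by ring]
        have := abs_add_le v β.im
        have hvabs : |v| ≤ ell1 D := abs_le.mpr ⟨hv1, hv2⟩
        linarith
      have h1 : ∑ x ∈ T, ‖x.ψ.LFunction (s + β)‖ ^ 2 ≤ CL' * frakP D * ell D ^ kL :=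
        (hL D χ hD₃ hq hp hA T (s + β) hw1re hw1im).trans
          (mul_le_mul_of_nonneg_right (mul_le_mul_of_nonneg_right (le_max_left _ _) hP0)
            (pow_nonneg hℓpos.le _))
      have h2 : ∑ x ∈ T, ‖x.ψ.LFunction (1 - conj s + β)‖ ^ 2 ≤ CL' * frakP D * ell D ^ kL :=
        (hL D χ hD₃ hq hp hA T (1 - conj s + β) hw2re hw2im).trans
          (mul_le_mul_of_nonneg_right (mul_le_mul_of_nonneg_right (le_max_left _ _) hP0)
            (pow_nonneg hℓpos.le _))
      calc ∑ x ∈ T, ‖H x s‖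
          ≤ ∑ x ∈ T, (‖x.ψ.LFunction (s + β)‖ ^ 2 + ‖x.ψ.LFunction (1 - conj s + β)‖ ^ 2) / 2 :=
            Finset.sum_le_sum fun x _ => hHle x
        _ = ((∑ x ∈ T, ‖x.ψ.LFunction (s + β)‖ ^ 2) +
              ∑ x ∈ T, ‖x.ψ.LFunction (1 - conj s + β)‖ ^ 2) / 2 := by
            rw [← Finset.sum_add_distrib, Finset.sum_div]
        _ ≤ (CL' * frakP D * ell D ^ kL + CL' * frakP D * ell D ^ kL) / 2 := by gcongr
        _ = CL' * frakP D * ell D ^ kL := by ring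
    -- integrate
    have hωcont : Continuous fun v : ℝ => ‖omegaW D ((z : ℂ) + s0 D + v * I)‖ :=
      ((Ded81Edge.continuous_omega (ell2 D) (t0 D)).comp
        (by fun_prop : Continuous fun v : ℝ => (z : ℂ) + s0 D + v * I)).norm
    have hint2 : IntervalIntegrable
        (fun v : ℝ => CL' * frakP D * ell D ^ kL * ‖omegaW D ((z : ℂ) + s0 D + v * I)‖)
        volume (-ell1 D) (ell1 D) := (continuous_const.mul hωcont).intervalIntegrable _ _
    have hintS : IntervalIntegrable (fun v : ℝ => ∑ x ∈ T,
        ‖H x ((z : ℂ) + s0 D + v * I)‖ * ‖omegaW D ((z : ℂ) + s0 D + v * I)‖) volume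
        (-ell1 D) (ell1 D) := by
      refine (continuousOn_finsetSum T fun x _ => hcont x).mono ?_ |>.intervalIntegrable
      rw [Set.uIcc_of_le (by linarith)]
    have hmono := intervalIntegral.integral_mono_on (by linarith : -ell1 D ≤ ell1 D) hintS hint2 hpt
    refine hmono.trans ?_
    rw [intervalIntegral.integral_const_mul]
    have hω74 : ∫ v in (-ell1 D)..ell1 D, ‖omegaW D ((z : ℂ) + s0 D + v * I)‖ ≤
        2 * π * Real.exp (1 / 4) := by
      have h := SmoothWeight.integral_norm_omega_segment_le_of_abs_le hℓ2pos (t0 D) hzabs hℓ1pos.le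
      simpa only [omegaW, s0] using h
    exact mul_le_mul_of_nonneg_left hω74
      (mul_nonneg (mul_nonneg hCL'0 hP0) (pow_nonneg hℓpos.le _))
  -- the remainder is absorbed: `Hmax · e^{−𝓛¹⁰/8} ≤ 16 Z²`
  have hrem : Hmax * Real.exp (-(ell D ^ 10 / 8)) ≤ 16 * Z ^ 2 := by
    have hwin : 2 * π * t0 D + ell1 D + 4 ≤ 8 * t0 D := by
      have hp := mul_nonneg (sub_nonneg.mpr (le_of_lt Real.pi_lt_d2)) ht00
      nlinarith
    have hM : Hmax ≤ 16 * Z ^ 2 * ((2 * bigP D) ^ 6 * (8 * t0 D) ^ 6) := by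
      rw [hHmax, hM₁]
      have h3 : 0 ≤ 4 * (2 * bigP D) ^ 3 * Z :=
        mul_nonneg (mul_nonneg (by norm_num) (pow_nonneg (by linarith) 3)) hZ0
      have hle : 4 * (2 * bigP D) ^ 3 * Z * (2 * π * t0 D + ell1 D + 4) ^ 3 ≤
          4 * (2 * bigP D) ^ 3 * Z * (8 * t0 D) ^ 3 :=
        mul_le_mul_of_nonneg_left (pow_le_pow_left₀ hwin0 hwin 3) h3
      have h0 : 0 ≤ 4 * (2 * bigP D) ^ 3 * Z * (2 * π * t0 D + ell1 D + 4) ^ 3 :=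
        mul_nonneg h3 (pow_nonneg hwin0 3)
      calc (4 * (2 * bigP D) ^ 3 * Z * (2 * π * t0 D + ell1 D + 4) ^ 3) ^ 2
          ≤ (4 * (2 * bigP D) ^ 3 * Z * (8 * t0 D) ^ 3) ^ 2 := pow_le_pow_left₀ h0 hle 2
        _ = 16 * Z ^ 2 * ((2 * bigP D) ^ 6 * (8 * t0 D) ^ 6) := by ring
    have he0 : 0 ≤ Real.exp (-(ell D ^ 10 / 8)) := (Real.exp_pos _).le
    calc Hmax * Real.exp (-(ell D ^ 10 / 8))
        ≤ 16 * Z ^ 2 * ((2 * bigP D) ^ 6 * (8 * t0 D) ^ 6) * Real.exp (-(ell D ^ 10 / 8)) :=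
          mul_le_mul_of_nonneg_right hM he0
      _ = 16 * Z ^ 2 * ((2 * bigP D) ^ 6 * (8 * t0 D) ^ 6 * Real.exp (-(ell D ^ 10 / 8))) := by ring
      _ ≤ 16 * Z ^ 2 * 1 := mul_le_mul_of_nonneg_left habs (by positivity)
      _ = 16 * Z ^ 2 := mul_one _
  -- assemble
  have hcard : (T.card : ℝ) ≤ frakP D := cardPsiOneLe_holds D χ
  have hℓk : 1 ≤ ell D ^ (kL + 9) := one_le_pow₀ hℓ1.le
  calc (∑ x ∈ T, ∑ ρ ∈ finsetOf (zeroSet D x),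
          ‖x.ψ.LFunction (ρ + beta1 c' D) / deriv x.ψ.LFunction ρ‖ * ‖F x ρ‖ ^ 2 * ‖omegaW D ρ‖)
      ≤ ∑ x ∈ T, (C₇ * ell D ^ 9 *
            ((∫ v in (-ell1 D)..ell1 D,
                ‖H x ((alpha D : ℂ) + s0 D + v * I)‖ * ‖omegaW D ((alpha D : ℂ) + s0 D + v * I)‖) +
              (∫ v in (-ell1 D)..ell1 D,
                ‖H x (((-alpha D : ℝ) : ℂ) + s0 D + v * I)‖ *
                  ‖omegaW D (((-alpha D : ℝ) : ℂ) + s0 D + v * I)‖)) +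
          K * Hmax * Real.exp (-(ell D ^ 10 / 8))) := Finset.sum_le_sum hx
    _ = C₇ * ell D ^ 9 *
          ((∑ x ∈ T, ∫ v in (-ell1 D)..ell1 D,
              ‖H x ((alpha D : ℂ) + s0 D + v * I)‖ * ‖omegaW D ((alpha D : ℂ) + s0 D + v * I)‖) +
            (∑ x ∈ T, ∫ v in (-ell1 D)..ell1 D,
              ‖H x (((-alpha D : ℝ) : ℂ) + s0 D + v * I)‖ *
                ‖omegaW D (((-alpha D : ℝ) : ℂ) + s0 D + v * I)‖)) +
          T.card * (K * Hmax * Real.exp (-(ell D ^ 10 / 8))) := by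
        rw [Finset.sum_add_distrib, Finset.sum_const, nsmul_eq_mul, ← Finset.mul_sum,
          Finset.sum_add_distrib]
    _ ≤ C₇ * ell D ^ 9 * (CL' * frakP D * ell D ^ kL * (2 * π * Real.exp (1 / 4)) +
            CL' * frakP D * ell D ^ kL * (2 * π * Real.exp (1 / 4))) +
          frakP D * (K * (16 * Z ^ 2)) := by
        have hK' : K * Hmax * Real.exp (-(ell D ^ 10 / 8)) ≤ K * (16 * Z ^ 2) := by
          rw [mul_assoc]; exact mul_le_mul_of_nonneg_left hrem hK0
        have hK0' : 0 ≤ K * Hmax * Real.exp (-(ell D ^ 10 / 8)) :=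
          mul_nonneg (mul_nonneg hK0 hHmax0) (Real.exp_pos _).le
        have h1 := hline (alpha D) (Or.inl rfl)
        have h2 := hline (-alpha D) (Or.inr rfl)
        refine add_le_add ?_ (mul_le_mul hcard hK' hK0' hP0)
        exact mul_le_mul_of_nonneg_left (add_le_add h1 h2)
          (mul_nonneg hC₇ (pow_nonneg hℓpos.le 9))
    _ = (2 * (C₇ * (2 * π * Real.exp (1 / 4))) * CL') * frakP D * (ell D ^ 9 * ell D ^ kL) +
          K * (16 * Z ^ 2) * frakP D * 1 := by ring
    _ ≤ (2 * (C₇ * (2 * π * Real.exp (1 / 4))) * CL') * frakP D * ell D ^ (kL + 9) +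
          K * (16 * Z ^ 2) * frakP D * ell D ^ (kL + 9) := by
        have h1 : ell D ^ 9 * ell D ^ kL = ell D ^ (kL + 9) := by rw [← pow_add, add_comm]
        rw [h1]
        have h0 : 0 ≤ K * (16 * Z ^ 2) * frakP D := mul_nonneg (mul_nonneg hK0 (by positivity)) hP0
        gcongr
    _ = (2 * (C₇ * (2 * π * Real.exp (1 / 4))) * CL' + K * (16 * Z ^ 2)) * frakP D *
          ell D ^ (kL + 9) := by ring

end Literature.NumberTheory.LFunctions.Zhang2022.Typed.Section13
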